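import Mathlib
import Literature.MathematicalPhysics.StatisticalMechanics.LennardJonesClusters
import Literature.MathematicalPhysics.StatisticalMechanics.BarlowStackingEnergy
import Literature.MathematicalPhysics.StatisticalMechanics.LocalMatchingCompactness
import Summits.AtomisticToContinuum.Crystallization.Theorems.MinMeanCycleStackingLockBarlowEnergyIdentification

/-!
# Far-paste surgery for `StackingFaultSparsity` (line `Sketch`), I:
# the punctured lattice sum of a Barlow stacking

Helper file of stub `stub_farPaste` of the crux `StackingFaultSparsity` (item
stmt-AtomisticToContinuum-14296, routes `SquareWellLayerCake` / `LaminarSixThreeThree`).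

* §1, uniformly discrete point sets `S ⊆ ℝ³` (`dist ≥ δ₀ > 0` between distinct points): bounded
  parts are finite (`finite_inter_closedBall_of_separated`), finite parts are enumerated as
  separated configurations (`exists_fin_enum_onto`), and seen from a point `z₀ ∈ S` both
  `∑_{z ≠ z₀} |z₀ - z|⁻⁶`
  and the Lennard-Jones sum `∑_{z ≠ z₀} V_LJ(|z₀ - z|)` converge absolutely
  (`summable_inv_pow_six_of_separated`, `summable_lennardJones_of_separated`: every partial sum is a
  shell sum `sum_inv_pow_six_le` of a finite separated configuration).
* §2, Barlow stackings `S = barlowStacking a h s` with `a, h > 0` and an ARBITRARY (non-periodic)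
  Hägg word `s`: the punctured Lennard-Jones sum at a point `P` of layer `k` equals
  `2 · barlowSiteEnergy lennardJones a h s k` (`tsum_stacking_eq_two_mul_barlowSiteEnergy`; the
  layer-by-layer regrouping of `tsum_points_eq_two_mul_barlowSiteEnergy`, whose only use of
  periodicity — summability — is replaced by §1), hence by `barlowSiteEnergy_eq` it is
  `2 e₀ + haggLocalEnergy + haggBackwardLocalEnergy ≥ 2 (e₀(a,h) - ∑_{k ≥ 2} |J_k(a,h)|)`
  (`latticeSiteSum_ge`), uniformly in the word.
-/

noncomputable section
namespace Summit.AtomisticToContinuum.Crystallization.Theorems.SquareWellLayerCake.StackingFaultSparsity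
open Literature.MathematicalPhysics.StatisticalMechanics

/-! ## 1. Separated point sets -/

/-- A bounded part of a uniformly discrete point set of `ℝ³` is finite. -/
theorem finite_inter_closedBall_of_separated {S : Set (EuclideanSpace ℝ (Fin 3))} {δ₀ : ℝ}
    (hδ₀ : 0 < δ₀) (hS : ∀ z ∈ S, ∀ z' ∈ S, z ≠ z' → δ₀ ≤ dist z z')
    (c : EuclideanSpace ℝ (Fin 3)) (ρ : ℝ) :
    (S ∩ Metric.closedBall c ρ).Finite :=
  finite_of_forall_le_dist_of_subset_closedBall hδ₀
    (fun p hp q hq hpq => hS p hp.1 q hq.1 hpq) Set.inter_subset_right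

/-- Enumeration of a finset `T ∋ z₀` of pairwise `≥ δ₀` separated points as a separated
configuration `y : Fin N → X` with `y i = z₀`, onto `T`, transporting sums over `T ∖ {z₀}` to sums
over `k ≠ i`. -/
theorem exists_fin_enum_onto {X : Type*} [MetricSpace X] [DecidableEq X] {δ₀ : ℝ}
    (T : Finset X) {z₀ : X} (hz₀ : z₀ ∈ T)
    (hsep : ∀ c ∈ T, ∀ d ∈ T, c ≠ d → δ₀ ≤ dist c d) :
    ∃ (N : ℕ) (y : Fin N → X) (i : Fin N), y i = z₀ ∧ (∀ k, y k ∈ T) ∧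
      (∀ z ∈ T, ∃ k, y k = z) ∧ (∀ k l : Fin N, k ≠ l → δ₀ ≤ dist (y k) (y l)) ∧
      ∀ Φ : X → ℝ, ∑ z ∈ T.erase z₀, Φ z = ∑ k ∈ Finset.univ.erase i, Φ (y k) := by
  -- adapted from `PricedHcpWindowsMatchedEnergy.exists_fin_enum`
  have hinj : Function.Injective fun k => (T.equivFin.symm k).1 :=
    Subtype.val_injective.comp T.equivFin.symm.injective
  refine ⟨T.card, fun k => (T.equivFin.symm k).1, T.equivFin ⟨z₀, hz₀⟩, by simp,
    fun k => (T.equivFin.symm k).2, fun z hz => ⟨T.equivFin ⟨z, hz⟩, by simp⟩,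
    fun k l hkl => hsep _ (T.equivFin.symm k).2 _ (T.equivFin.symm l).2 (hinj.ne hkl),
    fun Φ => ?_⟩
  have h1 : ∑ k : Fin T.card, Φ (T.equivFin.symm k).1 = ∑ z ∈ T, Φ z :=
    (Fintype.sum_equiv T.equivFin.symm _ (fun t : ↥T => Φ t.1) fun _ => rfl).trans
      (Finset.sum_coe_sort T Φ)
  rw [Finset.sum_erase_eq_sub hz₀, Finset.sum_erase_eq_sub (Finset.mem_univ _), h1]
  simp

/-- Over a uniformly discrete point set of `ℝ³`, `z ↦ |z₀ - z|⁻⁶` (`z ≠ z₀`) is summable (its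
partial sums are shell sums of finite separated configurations, `sum_inv_pow_six_le`). -/
theorem summable_inv_pow_six_of_separated {S : Set (EuclideanSpace ℝ (Fin 3))} {δ₀ : ℝ}
    (hδ₀ : 0 < δ₀) (hS : ∀ z ∈ S, ∀ z' ∈ S, z ≠ z' → δ₀ ≤ dist z z')
    {z₀ : EuclideanSpace ℝ (Fin 3)} (hz₀ : z₀ ∈ S) :
    Summable fun z : {z // z ∈ S ∧ z ≠ z₀} => (dist z₀ z.1)⁻¹ ^ 6 := by
  classical
  refine summable_of_sum_le (c := 250 * δ₀⁻¹ ^ 6) (fun z => by positivity) fun u => ?_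
  have hinj : Set.InjOn (fun z : {z // z ∈ S ∧ z ≠ z₀} => z.1) ↑u := fun z _ z' _ h =>
    Subtype.ext h
  obtain ⟨F, hF⟩ : ∃ F : Finset (EuclideanSpace ℝ (Fin 3)),
      F = u.image (fun z : {z // z ∈ S ∧ z ≠ z₀} => z.1) := ⟨_, rfl⟩
  have h1 : ∑ z ∈ u, (dist z₀ z.1)⁻¹ ^ 6 = ∑ w ∈ F, (dist z₀ w)⁻¹ ^ 6 := by
    rw [hF, Finset.sum_image hinj]
  have hFmem : ∀ w ∈ F, w ∈ S ∧ w ≠ z₀ := by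
    intro w hw
    rw [hF] at hw
    obtain ⟨z, -, rfl⟩ := Finset.mem_image.1 hw
    exact z.2
  have hz₀F : z₀ ∉ F := fun h0 => (hFmem z₀ h0).2 rfl
  have hTS : ∀ c ∈ insert z₀ F, c ∈ S := fun c hc => by
    rcases Finset.mem_insert.1 hc with rfl | hc
    exacts [hz₀, (hFmem c hc).1]
  rw [h1, ← Finset.erase_insert hz₀F]
  obtain ⟨N, y, i, hyi, -, -, hsep', hsum⟩ := exists_fin_enum_onto (insert z₀ F)
    (Finset.mem_insert_self z₀ F) (fun c hc d hd hcd => hS c (hTS c hc) d (hTS d hd) hcd)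
  rw [hsum (fun w => (dist z₀ w)⁻¹ ^ 6), ← hyi]
  exact sum_inv_pow_six_le y hδ₀ hsep' i

/-- Over a uniformly discrete point set of `ℝ³`, the Lennard-Jones sum seen from one of its points
converges absolutely (`|V_LJ(r)| ≤ (δ₀⁻⁶/12 + 1/6) r⁻⁶` for `r ≥ δ₀`). -/
theorem summable_lennardJones_of_separated {S : Set (EuclideanSpace ℝ (Fin 3))} {δ₀ : ℝ}
    (hδ₀ : 0 < δ₀) (hS : ∀ z ∈ S, ∀ z' ∈ S, z ≠ z' → δ₀ ≤ dist z z')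
    {z₀ : EuclideanSpace ℝ (Fin 3)} (hz₀ : z₀ ∈ S) :
    Summable fun z : {z // z ∈ S ∧ z ≠ z₀} => lennardJones (dist z₀ z.1) := by
  have h6 := summable_inv_pow_six_of_separated hδ₀ hS hz₀
  refine Summable.of_norm_bounded (h6.mul_left (1 / 12 * δ₀⁻¹ ^ 6 + 1 / 6)) fun z => ?_
  rw [Real.norm_eq_abs]
  have hd : δ₀ ≤ dist z₀ z.1 := hS z₀ hz₀ z.1 z.2.1 (Ne.symm z.2.2)
  have hd0 : 0 < dist z₀ z.1 := hδ₀.trans_le hd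
  set u : ℝ := (dist z₀ z.1)⁻¹ ^ 6 with hu
  have hu0 : 0 ≤ u := by positivity
  have huδ : u ≤ δ₀⁻¹ ^ 6 := pow_le_pow_left₀ (inv_nonneg.2 hd0.le) (inv_anti₀ hδ₀ hd) 6
  have h12 : (dist z₀ z.1)⁻¹ ^ 12 = u * u := by rw [hu]; ring
  have huu : u * u ≤ δ₀⁻¹ ^ 6 * u := mul_le_mul_of_nonneg_right huδ hu0
  unfold lennardJones
  rw [h12, abs_le]
  constructor <;> nlinarith

/-! ## 2. The punctured lattice sum of a Barlow stacking -/

/-- The Lennard-Jones sum over a Barlow stacking (`a, h > 0`, any word), seen from one of its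
points, is summable in the parametrisation by `ℤ³`. -/
theorem summable_lennardJones_barlowPos_of_word {a h : ℝ} (ha : 0 < a) (hh : 0 < h) (s : ℤ → ℤ)
    (k₀ i₀ j₀ : ℤ) :
    Summable fun q : ℤ × ℤ × ℤ =>
      lennardJones (dist (barlowPos a h s k₀ i₀ j₀) (barlowPos a h s q.1 q.2.1 q.2.2)) := by
  -- adapted from `summable_lennardJones_barlowPos` (periodic words)
  have hSsep : ∀ z ∈ barlowStacking a h s, ∀ z' ∈ barlowStacking a h s, z ≠ z' →
      min a h ≤ dist z z' := fun z hz z' hz' hne =>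
    le_dist_of_mem_barlowStacking a h s ha.le hh.le hz hz' hne
  have hF := summable_lennardJones_of_separated (lt_min ha hh) hSsep (barlowPos_mem k₀ i₀ j₀)
  set x := barlowPos a h s k₀ i₀ j₀ with hxdef
  set g : ℤ × ℤ × ℤ → EuclideanSpace ℝ (Fin 3) := fun q => barlowPos a h s q.1 q.2.1 q.2.2
    with hgdef
  have hg : Function.Injective g := barlowPos_injective ha hh s
  have hfin : (g ⁻¹' {x}).Finite := (Set.subsingleton_singleton.preimage hg).finite
  let φ : ↥(g ⁻¹' {x})ᶜ → {y // y ∈ barlowStacking a h s ∧ y ≠ x} :=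
    fun c => ⟨g c.1, barlowPos_mem _ _ _, fun hc => c.2 hc⟩
  have hφ : Function.Injective φ := by
    intro c c' hcc'
    have h1 : g c.1 = g c'.1 := congrArg Subtype.val hcc'
    exact Subtype.ext (hg h1)
  have h1 : Summable ((fun y : {y // y ∈ barlowStacking a h s ∧ y ≠ x} =>
      lennardJones (dist x y.1)) ∘ φ) := hF.comp_injective hφ
  have h2 : Summable ((fun q : ℤ × ℤ × ℤ => lennardJones (dist x (g q))) ∘
      ((↑) : ↥(g ⁻¹' {x})ᶜ → ℤ × ℤ × ℤ)) := h1
  exact hfin.summable_compl_iff.1 h2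

/-- The punctured Lennard-Jones sum over the stacking seen from a stacking point is the full
`ℤ³`-parametrised sum (the missing diagonal term is `V_LJ(0) = 0`). -/
theorem tsum_stacking_eq_tsum_barlowPos {a h : ℝ} (ha : 0 < a) (hh : 0 < h) (s : ℤ → ℤ)
    (k₀ i₀ j₀ : ℤ) :
    ∑' y : {y // y ∈ barlowStacking a h s ∧ y ≠ barlowPos a h s k₀ i₀ j₀},
        lennardJones (dist (barlowPos a h s k₀ i₀ j₀) y.1) =
      ∑' q : ℤ × ℤ × ℤ,
        lennardJones (dist (barlowPos a h s k₀ i₀ j₀) (barlowPos a h s q.1 q.2.1 q.2.2)) := by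
  -- adapted from `tsum_points_eq_tsum_barlowPos` (periodic words)
  set g : ℤ × ℤ × ℤ → EuclideanSpace ℝ (Fin 3) := fun q => barlowPos a h s q.1 q.2.1 q.2.2
    with hgdef
  have hg : Function.Injective g := barlowPos_injective ha hh s
  set q₀ : ℤ × ℤ × ℤ := (k₀, i₀, j₀) with hq₀
  have hx : g q₀ = barlowPos a h s k₀ i₀ j₀ := rfl
  let φ : ↥({q₀}ᶜ : Set (ℤ × ℤ × ℤ)) →
      {y // y ∈ barlowStacking a h s ∧ y ≠ barlowPos a h s k₀ i₀ j₀} :=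
    fun c => ⟨g c.1, barlowPos_mem _ _ _, fun hc => c.2 (hg (hc.trans hx.symm))⟩
  have hφ : Function.Injective φ := by
    intro c c' hcc'
    have h1 : g c.1 = g c'.1 := congrArg Subtype.val hcc'
    exact Subtype.ext (hg h1)
  have hsurj : Function.support
      (fun y : {y // y ∈ barlowStacking a h s ∧ y ≠ barlowPos a h s k₀ i₀ j₀} =>
        lennardJones (dist (barlowPos a h s k₀ i₀ j₀) y.1)) ⊆ Set.range φ := by
    intro y _
    obtain ⟨k, i, j, hk⟩ := y.2.1
    have hne : ((k, i, j) : ℤ × ℤ × ℤ) ∈ ({q₀}ᶜ : Set (ℤ × ℤ × ℤ)) := by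
      intro hq
      have hq' : g (k, i, j) = g q₀ := by rw [Set.mem_singleton_iff.1 hq]
      exact y.2.2 (hk.trans (hq'.trans hx))
    exact ⟨⟨(k, i, j), hne⟩, Subtype.ext hk.symm⟩
  rw [← hφ.tsum_eq hsurj]
  have h0 : Function.support (fun q : ℤ × ℤ × ℤ =>
      lennardJones (dist (barlowPos a h s k₀ i₀ j₀) (g q))) ⊆ ({q₀}ᶜ : Set (ℤ × ℤ × ℤ)) := by
    intro q hq
    rw [Function.mem_support] at hq
    simp only [Set.mem_compl_iff, Set.mem_singleton_iff]
    rintro rfl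
    exact hq (by simp only [hx, dist_self, lennardJones_zero])
  exact tsum_subtype_eq_of_support_subset h0

/-- In-layer translation invariance: the `ℤ³`-sum seen from `barlowPos k₀ i₀ j₀` equals the one
seen from the base point `barlowPos k₀ 0 0` of the same layer. -/
theorem tsum_barlowPos_shift {a h : ℝ} (s : ℤ → ℤ) (k₀ i₀ j₀ : ℤ) (Φ : ℝ → ℝ) :
    ∑' q : ℤ × ℤ × ℤ, Φ (dist (barlowPos a h s k₀ i₀ j₀) (barlowPos a h s q.1 q.2.1 q.2.2)) =
      ∑' q : ℤ × ℤ × ℤ, Φ (dist (barlowPos a h s k₀ 0 0) (barlowPos a h s q.1 q.2.1 q.2.2)) := by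
  set e : ℤ × ℤ × ℤ ≃ ℤ × ℤ × ℤ :=
    (Equiv.refl ℤ).prodCongr ((Equiv.addRight i₀).prodCongr (Equiv.addRight j₀)) with he
  calc ∑' q : ℤ × ℤ × ℤ, Φ (dist (barlowPos a h s k₀ i₀ j₀) (barlowPos a h s q.1 q.2.1 q.2.2))
      = ∑' q : ℤ × ℤ × ℤ,
          Φ (dist (barlowPos a h s k₀ i₀ j₀) (barlowPos a h s (e q).1 (e q).2.1 (e q).2.2)) :=
        (e.tsum_eq (fun q : ℤ × ℤ × ℤ =>
          Φ (dist (barlowPos a h s k₀ i₀ j₀) (barlowPos a h s q.1 q.2.1 q.2.2)))).symm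
    _ = _ := tsum_congr fun q => by
        simp only [he, Equiv.prodCongr_apply, Prod.map_fst, Prod.map_snd, Equiv.refl_apply,
          Equiv.coe_addRight, dist_barlowPos_eq_norm_layerVec, add_sub_cancel_right, sub_zero]

/-- The `ℤ³`-sum seen from the base point of layer `m` is `2 · barlowSiteEnergy` (the same sum
organised layer by layer; any word, `a, h > 0`). -/
theorem tsum_barlowPos_eq_two_mul_barlowSiteEnergy_of_word {a h : ℝ} (ha : 0 < a) (hh : 0 < h)
    (s : ℤ → ℤ) (m : ℤ) :
    ∑' q : ℤ × ℤ × ℤ,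
        lennardJones (dist (barlowPos a h s m 0 0) (barlowPos a h s q.1 q.2.1 q.2.2)) =
      2 * barlowSiteEnergy lennardJones a h s m := by
  -- adapted from `tsum_points_eq_two_mul_barlowSiteEnergy` (periodic words): only `hF` changes
  have hF := summable_lennardJones_barlowPos_of_word ha hh s m 0 0
  have e2 : ∑' q : ℤ × ℤ × ℤ,
      lennardJones (dist (barlowPos a h s m 0 0) (barlowPos a h s q.1 q.2.1 q.2.2)) =
      ∑' k : ℤ, layerInteraction lennardJones a h (haggLabel s k - haggLabel s m) (k - m) :=
    hF.tsum_prod.trans (tsum_congr fun k => tsum_layer lennardJones a h s m k)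
  have hG : Summable fun k : ℤ =>
      layerInteraction lennardJones a h (haggLabel s k - haggLabel s m) (k - m) :=
    hF.prod.congr fun k => tsum_layer lennardJones a h s m k
  have e1 : ∑' k : ℤ, layerInteraction lennardJones a h (haggLabel s k - haggLabel s m) (k - m) =
      ∑' t : ℤ, layerInteraction lennardJones a h (haggLabel s (m + t) - haggLabel s m)
        (m + t - m) :=
    ((Equiv.addLeft m).tsum_eq fun k =>
      layerInteraction lennardJones a h (haggLabel s k - haggLabel s m) (k - m)).symm
  have hG' : Summable fun t : ℤ =>
      layerInteraction lennardJones a h (haggLabel s (m + t) - haggLabel s m) (m + t - m) :=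
    hG.comp_injective (Equiv.addLeft m).injective
  have h1 : Summable fun n : ℕ => layerInteraction lennardJones a h
      (haggLabel s (m + ((n : ℤ) + 1)) - haggLabel s m) (m + ((n : ℤ) + 1) - m) :=
    hG'.comp_injective (i := fun n : ℕ => (n : ℤ) + 1)
      fun n n' (hn : (n : ℤ) + 1 = (n' : ℤ) + 1) => by omega
  have h2 : Summable fun n : ℕ => layerInteraction lennardJones a h
      (haggLabel s (m + -((n : ℤ) + 1)) - haggLabel s m) (m + -((n : ℤ) + 1) - m) :=
    hG'.comp_injective (i := fun n : ℕ => -((n : ℤ) + 1))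
      fun n n' (hn : -((n : ℤ) + 1) = -((n' : ℤ) + 1)) => by omega
  have e3 : ∑' t : ℤ, layerInteraction lennardJones a h (haggLabel s (m + t) - haggLabel s m)
        (m + t - m) =
      (∑' n : ℕ, layerInteraction lennardJones a h
        (haggLabel s (m + ((n : ℤ) + 1)) - haggLabel s m) (m + ((n : ℤ) + 1) - m)) +
      layerInteraction lennardJones a h (haggLabel s (m + 0) - haggLabel s m) (m + 0 - m) +
      ∑' n : ℕ, layerInteraction lennardJones a h
        (haggLabel s (m + -((n : ℤ) + 1)) - haggLabel s m) (m + -((n : ℤ) + 1) - m) :=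
    tsum_of_add_one_of_neg_add_one (f := fun t : ℤ =>
      layerInteraction lennardJones a h (haggLabel s (m + t) - haggLabel s m) (m + t - m)) h1 h2
  have e0 : layerInteraction lennardJones a h (haggLabel s (m + 0) - haggLabel s m) (m + 0 - m) =
      ∑' ij : ℤ × ℤ, (if ij = 0 then 0 else
        lennardJones (dist (barlowPos a h s m 0 0) (barlowPos a h s m ij.1 ij.2))) := by
    rw [add_zero, sub_self, sub_self, tsum_inLayer, layerInteraction, inLayerInteraction]
    refine tsum_congr fun ij => ?_
    split_ifs with hij
    · subst hij
      simp [layerVec, lennardJones_zero]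
    · rw [layerVec_zero_zero]
  have eB : (∑' n : ℕ, layerInteraction lennardJones a h
        (haggLabel s (m + ((n : ℤ) + 1)) - haggLabel s m) (m + ((n : ℤ) + 1) - m)) =
      ∑' k : ℕ, ∑' ij : ℤ × ℤ, lennardJones
        (dist (barlowPos a h s m 0 0) (barlowPos a h s (m + (k + 1 : ℕ)) ij.1 ij.2)) :=
    tsum_congr fun n => by
      rw [tsum_layer]
      have : m + ((n : ℤ) + 1) = m + ((n + 1 : ℕ) : ℤ) := by push_cast; ring
      rw [this]
  have eC : (∑' n : ℕ, layerInteraction lennardJones a h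
        (haggLabel s (m + -((n : ℤ) + 1)) - haggLabel s m) (m + -((n : ℤ) + 1) - m)) =
      ∑' k : ℕ, ∑' ij : ℤ × ℤ, lennardJones
        (dist (barlowPos a h s m 0 0) (barlowPos a h s (m - (k + 1 : ℕ)) ij.1 ij.2)) :=
    tsum_congr fun n => by
      rw [tsum_layer]
      have : m + -((n : ℤ) + 1) = m - ((n + 1 : ℕ) : ℤ) := by push_cast; ring
      rw [this]
  rw [e2, e1, e3, e0, eB, eC, barlowSiteEnergy]
  ring

/-- A signed sub-sum `∑'_{k ≥ 2, P k} J_k` of a summable sequence is bounded by `∑'_n |J_{n+2}|`. -/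
private theorem abs_tsum_ite_le {J : ℕ → ℝ} (hJ : Summable J) (P : ℕ → Prop) [DecidablePred P] :
    |∑' k, (if 2 ≤ k ∧ P k then J k else 0)| ≤ ∑' n, |J (n + 2)| := by
  have hf : Summable fun k => if 2 ≤ k ∧ P k then J k else 0 := summable_ite_of_summable hJ _
  have hg : Summable fun k : ℕ => if 2 ≤ k then |J k| else 0 := summable_ite_of_summable hJ.abs _
  have hfn : Summable fun k => ‖if 2 ≤ k ∧ P k then J k else 0‖ := hf.norm
  have h1 : ‖∑' k, (if 2 ≤ k ∧ P k then J k else 0)‖ ≤ ∑' k, ‖if 2 ≤ k ∧ P k then J k else 0‖ :=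
    norm_tsum_le_tsum_norm hfn
  have h2 : ∑' k, ‖if 2 ≤ k ∧ P k then J k else 0‖ ≤ ∑' k : ℕ, if 2 ≤ k then |J k| else 0 := by
    refine hfn.tsum_le_tsum (fun k => ?_) hg
    by_cases hk : 2 ≤ k <;> by_cases hP : P k <;> simp [hk, hP]
  have h3 : ∑' k : ℕ, (if 2 ≤ k then |J k| else 0) = ∑' n, |J (n + 2)| := by
    rw [← hg.sum_add_tsum_nat_add 2]
    simp [Finset.sum_range_succ]
  rw [Real.norm_eq_abs] at h1
  linarith

/-- **The punctured Lennard-Jones lattice sum at a point of a Barlow stacking is at least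
`2 (e₀ - ∑_{k ≥ 2} |J_k|)`** (`a, h > 0`, `s` a Hägg word): it equals `2 · barlowSiteEnergy` of
the point's layer, i.e. `2 e₀ + haggLocalEnergy + haggBackwardLocalEnergy` (`barlowSiteEnergy_eq`),
and each local energy is a signed sub-sum of the couplings `J_k`, `k ≥ 2`. -/
theorem latticeSiteSum_ge {a h : ℝ} (ha : 0 < a) (hh : 0 < h) {s : ℤ → ℤ}
    (hs : IsHaggSeq s) (k i j : ℤ) :
    2 * (barlowBaseEnergy lennardJones a h -
        ∑' n : ℕ, |barlowCoupling lennardJones a h (n + 2)|) ≤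
      ∑' z : {z // z ∈ barlowStacking a h s ∧ z ≠ barlowPos a h s k i j},
        lennardJones (dist (barlowPos a h s k i j) z.1) := by
  have hA := summable_layerInteraction_lennardJones ha hh 0
  have hN := summable_layerInteraction_lennardJones ha hh 1
  have hJ : Summable fun n : ℕ => barlowCoupling lennardJones a h n := hA.sub hN
  rw [tsum_stacking_eq_tsum_barlowPos ha hh s k i j, tsum_barlowPos_shift s k i j lennardJones,
    tsum_barlowPos_eq_two_mul_barlowSiteEnergy_of_word ha hh s k,
    barlowSiteEnergy_eq lennardJones a h hs hA hN k]
  have h1 : |haggLocalEnergy (barlowCoupling lennardJones a h) s k| ≤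
      ∑' n, |barlowCoupling lennardJones a h (n + 2)| :=
    abs_tsum_ite_le hJ fun n => HaggAligned s k n
  have h2 : |haggBackwardLocalEnergy (barlowCoupling lennardJones a h) s k| ≤
      ∑' n, |barlowCoupling lennardJones a h (n + 2)| :=
    abs_tsum_ite_le hJ fun n => HaggAligned s (k - n) n
  rw [abs_le] at h1 h2
  linarith [h1.1, h2.1]

/-- **Carrier of part I** (colon form of `latticeSiteSum_ge`, registered as a stub of line `Sketch`
so that this helper file lands under `--supports`): for `a, h > 0` and a Hägg word `s`, the punctured
Lennard-Jones lattice sum at every point of `barlowStacking a h s` is at least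
`2 (e₀(a,h) - ∑_{k ≥ 2} |J_k(a,h)|)`. -/
theorem farPasteLattice_carrier :
    ∀ (a h : ℝ), 0 < a → 0 < h → ∀ (s : ℤ → ℤ), IsHaggSeq s → ∀ (k i j : ℤ),
      2 * (barlowBaseEnergy lennardJones a h -
          ∑' n : ℕ, |barlowCoupling lennardJones a h (n + 2)|) ≤
        ∑' z : {z // z ∈ barlowStacking a h s ∧ z ≠ barlowPos a h s k i j},
          lennardJones (dist (barlowPos a h s k i j) z.1) :=
  fun _ _ ha hh _ hs k i j => latticeSiteSum_ge ha hh hs k i j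

end Summit.AtomisticToContinuum.Crystallization.Theorems.SquareWellLayerCake.StackingFaultSparsity

end
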